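import Literature.Barriers.CriticalPhenomena.WeaklySAWFlowContraction
import Literature.Barriers.CriticalPhenomena.WeaklySAWSeqSpaceShift
import HarnessLib

/-!
# [BBS-rg-flow, Lemma 3.3 (differentiability part) for the flow map `T`]: `T` is strictly Fréchet
# differentiable on the open unit ball of `ℓ^∞(∏𝒲_j) × ℓ^∞(ℝ³)`, with `‖DT‖ ≤ θ`

File of the series formalising [BBS-rg-flow] (Bauerschmidt–Brydges–Slade, AHP 16 (2015),
arXiv:1211.2477) towards `Literature.Barriers.CriticalPhenomena.WeaklySAWFourDimLogCorrections`, for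
Theorem 1.4(ii) (= BBS 2015, Theorem 7.2.1(ii): smooth dependence of the critical flow on `g₀`);
continuation of `WeaklySAWFlowContraction.lean` (the flow map `T` in scaled coordinates, a `θ`-contraction
of the ball) and of `WeaklySAWSeqSpaceCalculus.lean` / `WeaklySAWSeqSpaceShift.lean` (componentwise
calculus on `ℓ^∞`).

Lemma 3.3 of the source states that, by Assumption (A3), the inserted maps `ψ, ρ : x̄ + 𝔹 → X^𝗏` are twice
continuously Fréchet differentiable on the ball of the weighted sequence space, with
`‖D²φ‖_{L²(X^𝗐,X^𝗏)} ≤ C` ("immediate consequences of Assumption (A3) … and the definition of the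
weights"); this is the regularity of the flow map that §3.4 feeds into the implicit-function /
ODE argument for Theorem 1.4(ii). Here it is proved for the map `T` of `WeaklySAWFlowMap.lean`:
* `flowDomain_mem_nhds_of_lt`: strict versions of the four inequalities defining `D_j` give a
  neighbourhood; `MixedDerivBound.norm_two_le`: the order-two case of (1.13) on general (non-pure)
  directions, by bilinearity;
* the one-scale maps `stepK_j` (`𝗐_{K,j+1}⁻¹[ψ_j(x_j(y)) - ψ_j(x̄_j)]`) and `stepN_j`
  (`𝗏_{V,j+1}⁻¹[Q_j(𝗐_VṼ) + ρ_j(x_j(y))]`) with `(T^Kỹ)_{j+1} = stepK_j(ỹ_j)`, `Ñ_{j+1}(ỹ) = stepN_j(ỹ_j)`,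
  their Fréchet derivatives `stepKDeriv`, `stepNDeriv` on the open unit ball (chain rule through the
  affine map `y ↦ x_j(y)`; (A3) is used at INTERIOR points of `D_j`, where `ψ_j, ρ_j` are `C³`);
* the LIPSCHITZ bounds of these derivatives, uniformly in `j` (`norm_stepKDeriv_sub_le`,
  `norm_stepNDeriv_sub_le`): the second derivatives of (1.13) in the weighted norms are `O(1)`
  (constants `derivLipK`, `derivLipN`), the printed `‖D²_xφ(x)‖_{L²(X^𝗐,X^𝗏)} ≤ C`;
* **`hasStrictFDerivAt_Tmap`**: for `‖ỹ‖ < 1`, `T` is strictly Fréchet differentiable at `ỹ`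
  (`hasStrictFDerivAt_lpNemytskii` scale by scale, `lpZip`/`lpCons` for the shift `j ↦ j+1`, and
  the bounded operator `S̄_{𝒱𝒱}`), and **`norm_fderiv_Tmap_le`**: `‖DT(ỹ)‖ ≤ θ` inside the ball on
  which `T` is a `θ`-contraction.

## References
* R. Bauerschmidt, D. C. Brydges, G. Slade, *Structural stability of a dynamical system near a
  non-hyperbolic fixed point*, Ann. Henri Poincaré 16 (2015), arXiv:1211.2477: Assumption (A3)
  (1.11)–(1.13), Lemma 3.3 (3.9)–(3.13), §3.4. [BauerschmidtBrydgesSlade2015Flow]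
* R. Bauerschmidt, D. C. Brydges, G. Slade, CMP 338 (2015), arXiv:1403.7422, Theorem 7.2.1(ii).
  [BauerschmidtBrydgesSlade2015LogCorr]
-/

noncomputable section

open Filter Topology Set
open scoped BigOperators ENNReal NNReal

namespace Literature.Barriers.CriticalPhenomena

namespace CTWSAW

/-! ## Interior points of `D_j` and the order-two case of the mixed-derivative bound (1.13) -/

section General

variable {E F : Type*} [NormedAddCommGroup E] [NormedSpace ℝ E] [NormedAddCommGroup F] [NormedSpace ℝ F]

omit [NormedSpace ℝ E] in
/-- Strict versions of the four inequalities of (1.10) place `x` in the interior of `D_j`.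
[cite: BauerschmidtBrydgesSlade2015Flow, §1.3, (1.10)] -/
theorem flowDomain_mem_nhds_of_lt {χ : ℕ → ℝ} {Vb : ℕ → V3} {a hh : ℝ} {j : ℕ} {x : E × V3}
    (h1 : ‖x.1‖ < a * χ j * Vb j 0 ^ 3) (h2 : |x.2 0 - Vb j 0| < hh * Vb j 0 ^ 2 * |Real.log (Vb j 0)|)
    (h3 : |x.2 1 - Vb j 1| < hh * χ j * Vb j 0 ^ 2 * |Real.log (Vb j 0)|)
    (h4 : |x.2 2 - Vb j 2| < hh * χ j * Vb j 0 ^ 2 * |Real.log (Vb j 0)|) :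
    flowDomain χ Vb a hh j ∈ 𝓝 x := by
  set U : Set (E × V3) := {x | ‖x.1‖ < a * χ j * Vb j 0 ^ 3 ∧
      |x.2 0 - Vb j 0| < hh * Vb j 0 ^ 2 * |Real.log (Vb j 0)| ∧
      |x.2 1 - Vb j 1| < hh * χ j * Vb j 0 ^ 2 * |Real.log (Vb j 0)| ∧
      |x.2 2 - Vb j 2| < hh * χ j * Vb j 0 ^ 2 * |Real.log (Vb j 0)|} with hU
  have hopen : IsOpen U := by
    have c1 : Continuous fun x : E × V3 => ‖x.1‖ := continuous_norm.comp continuous_fst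
    have c2 : ∀ i : Fin 3, Continuous fun x : E × V3 => |x.2 i - Vb j i| := fun i =>
      continuous_abs.comp (((continuous_apply i).comp continuous_snd).sub continuous_const)
    refine (isOpen_lt c1 continuous_const).inter ((isOpen_lt (c2 0) continuous_const).inter
      ((isOpen_lt (c2 1) continuous_const).inter (isOpen_lt (c2 2) continuous_const)))
  have hsub : U ⊆ flowDomain χ Vb a hh j := fun x hx => ⟨hx.1.le, hx.2.1.le, hx.2.2.1.le, hx.2.2.2.le⟩
  exact Filter.mem_of_superset (hopen.mem_nhds ⟨h1, h2, h3, h4⟩) hsub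

/-- **The order-two case of (1.13), two `K`-slots**: `‖D_K²φ(x)[k,k']‖ ≤ MA⁻¹‖k‖‖k'‖`.
[cite: BauerschmidtBrydgesSlade2015Flow, Assumption (A3), (1.13)] -/
theorem MixedDerivBound.two_KK {φ : E × V3 → F} {D : Set (E × V3)} {x : E × V3} {M A Bq : ℝ}
    (h : MixedDerivBound φ D x M A Bq) (k k' : E) :
    ‖iteratedFDerivWithin ℝ 2 φ D x ![(k, 0), (k', 0)]‖ ≤ M * A⁻¹ * (‖k‖ * ‖k'‖) := by
  have := h 2 le_rfl (by norm_num) ![true, true] ![k, k'] ![0, 0]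
  have e : (fun i : Fin 2 => pureDir (![true, true] i) (![k, k'] i) (![(0 : V3), 0] i)) = ![(k, 0), (k', 0)] := by
    funext i; fin_cases i <;> rfl
  rw [e] at this
  refine this.trans (le_of_eq ?_)
  simp only [Finset.card_filter, Fin.sum_univ_two, Fin.prod_univ_two, Matrix.cons_val_zero,
    Matrix.cons_val_one]
  norm_num [zpow_neg, zpow_ofNat, zpow_natCast]

/-- **The order-two case of (1.13), one `K`- and one `V`-slot**: `‖D_VD_Kφ(x)[k,v']‖ ≤ MBq⁻¹‖k‖‖v'‖`.
[cite: BauerschmidtBrydgesSlade2015Flow, Assumption (A3), (1.13)] -/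
theorem MixedDerivBound.two_KV {φ : E × V3 → F} {D : Set (E × V3)} {x : E × V3} {M A Bq : ℝ}
    (h : MixedDerivBound φ D x M A Bq) (k : E) (v' : V3) :
    ‖iteratedFDerivWithin ℝ 2 φ D x ![(k, 0), (0, v')]‖ ≤ M * Bq⁻¹ * (‖k‖ * ‖v'‖) := by
  have := h 2 le_rfl (by norm_num) ![true, false] ![k, 0] ![0, v']
  have e : (fun i : Fin 2 => pureDir (![true, false] i) (![k, (0 : E)] i) (![(0 : V3), v'] i)) = ![(k, 0), (0, v')] := by
    funext i; fin_cases i <;> rfl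
  rw [e] at this
  refine this.trans (le_of_eq ?_)
  simp only [Finset.card_filter, Fin.sum_univ_two, Fin.prod_univ_two, Matrix.cons_val_zero,
    Matrix.cons_val_one]
  norm_num

/-- **The order-two case of (1.13), one `V`- and one `K`-slot**: `‖D_KD_Vφ(x)[v,k']‖ ≤ MBq⁻¹‖v‖‖k'‖`.
[cite: BauerschmidtBrydgesSlade2015Flow, Assumption (A3), (1.13)] -/
theorem MixedDerivBound.two_VK {φ : E × V3 → F} {D : Set (E × V3)} {x : E × V3} {M A Bq : ℝ}
    (h : MixedDerivBound φ D x M A Bq) (v : V3) (k' : E) :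
    ‖iteratedFDerivWithin ℝ 2 φ D x ![(0, v), (k', 0)]‖ ≤ M * Bq⁻¹ * (‖v‖ * ‖k'‖) := by
  have := h 2 le_rfl (by norm_num) ![false, true] ![0, k'] ![v, 0]
  have e : (fun i : Fin 2 => pureDir (![false, true] i) (![(0 : E), k'] i) (![v, (0 : V3)] i)) = ![(0, v), (k', 0)] := by
    funext i; fin_cases i <;> rfl
  rw [e] at this
  refine this.trans (le_of_eq ?_)
  simp only [Finset.card_filter, Fin.sum_univ_two, Fin.prod_univ_two, Matrix.cons_val_zero,
    Matrix.cons_val_one]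
  norm_num

/-- **The order-two case of (1.13), two `V`-slots**: `‖D_V²φ(x)[v,v']‖ ≤ MABq⁻²‖v‖‖v'‖`.
[cite: BauerschmidtBrydgesSlade2015Flow, Assumption (A3), (1.13)] -/
theorem MixedDerivBound.two_VV {φ : E × V3 → F} {D : Set (E × V3)} {x : E × V3} {M A Bq : ℝ}
    (h : MixedDerivBound φ D x M A Bq) (v v' : V3) :
    ‖iteratedFDerivWithin ℝ 2 φ D x ![(0, v), (0, v')]‖ ≤ M * A * (Bq ^ 2)⁻¹ * (‖v‖ * ‖v'‖) := by
  have := h 2 le_rfl (by norm_num) ![false, false] ![0, 0] ![v, v']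
  have e : (fun i : Fin 2 => pureDir (![false, false] i) (![(0 : E), 0] i) (![v, v'] i)) = ![(0, v), (0, v')] := by
    funext i; fin_cases i <;> rfl
  rw [e] at this
  refine this.trans (le_of_eq ?_)
  simp only [Finset.card_filter, Fin.sum_univ_two, Fin.prod_univ_two, Matrix.cons_val_zero,
    Matrix.cons_val_one]
  norm_num [zpow_neg, zpow_ofNat, zpow_natCast]

/-- **(1.13) at order two on general directions** (bilinearity: `(k,v) = (k,0) + (0,v)`): for `x ∈ D`
with unique differentiability,
`‖D²φ(x)[(k,v),(k',v')]‖ ≤ M(A⁻¹‖k‖‖k'‖ + Bq⁻¹‖k‖‖v'‖ + Bq⁻¹‖v‖‖k'‖ + ABq⁻²‖v‖‖v'‖)`.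
[cite: BauerschmidtBrydgesSlade2015Flow, Assumption (A3), (1.13) and Lemma 3.3 ("‖D²_xφ(x)‖ ≤ C")] -/
theorem MixedDerivBound.norm_two_le {φ : E × V3 → F} {D : Set (E × V3)} {x : E × V3} {M A Bq : ℝ}
    (h : MixedDerivBound φ D x M A Bq) (hD : UniqueDiffOn ℝ D) (hx : x ∈ D) (k k' : E) (v v' : V3) :
    ‖fderivWithin ℝ (fderivWithin ℝ φ D) D x (k, v) (k', v')‖ ≤
      M * (A⁻¹ * (‖k‖ * ‖k'‖) + Bq⁻¹ * (‖k‖ * ‖v'‖) + Bq⁻¹ * (‖v‖ * ‖k'‖) + A * (Bq ^ 2)⁻¹ * (‖v‖ * ‖v'‖)) := by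
  set T := fderivWithin ℝ (fderivWithin ℝ φ D) D x with hT
  have happ : ∀ d₀ d₁ : E × V3, T d₀ d₁ = iteratedFDerivWithin ℝ 2 φ D x ![d₀, d₁] := fun d₀ d₁ => by
    rw [iteratedFDerivWithin_two_apply φ hD hx]; rfl
  have hsplit : T (k, v) (k', v') = T (k, 0) (k', 0) + T (k, 0) (0, v') + T (0, v) (k', 0) + T (0, v) (0, v') := by
    have e1 : ((k, v) : E × V3) = (k, 0) + (0, v) := by simp
    have e2 : ((k', v') : E × V3) = (k', 0) + (0, v') := by simp
    rw [e1, e2]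
    simp only [map_add, add_apply]
    abel
  rw [hsplit]
  have hKK := h.two_KK k k'
  have hKV := h.two_KV k v'
  have hVK := h.two_VK v k'
  have hVV := h.two_VV v v'
  rw [← happ] at hKK hKV hVK hVV
  calc ‖T (k, 0) (k', 0) + T (k, 0) (0, v') + T (0, v) (k', 0) + T (0, v) (0, v')‖
      ≤ ‖T (k, 0) (k', 0)‖ + ‖T (k, 0) (0, v')‖ + ‖T (0, v) (k', 0)‖ + ‖T (0, v) (0, v')‖ :=
        (norm_add_le _ _).trans (add_le_add ((norm_add_le _ _).trans
          (add_le_add (norm_add_le _ _) le_rfl)) le_rfl)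
    _ ≤ M * A⁻¹ * (‖k‖ * ‖k'‖) + M * Bq⁻¹ * (‖k‖ * ‖v'‖) + M * Bq⁻¹ * (‖v‖ * ‖k'‖) +
          M * A * (Bq ^ 2)⁻¹ * (‖v‖ * ‖v'‖) := add_le_add (add_le_add (add_le_add hKK hKV) hVK) hVV
    _ = _ := by ring

end General

/-! ## The one-scale maps `stepK_j`, `stepN_j` of `T` and their Fréchet derivatives -/

section OneScale

variable {W : ℕ → Type*} [∀ j, NormedAddCommGroup (W j)] [∀ j, NormedSpace ℝ (W j)]

/-- The linear map `Ṽ ↦ (𝗐_{g,j}g̃, 𝗐_{z,j}z̃, 𝗐_{μ,j}μ̃)` underlying `physV`. [cite: BauerschmidtBrydgesSlade2015Flow, §3.2, (3.1)–(3.2)] -/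
def physVLin (P : QuadFlowParams) (Ω : ℝ) (k : ℕ∞) (g₀ hh : ℝ) (j : ℕ) : V3 →ₗ[ℝ] V3 where
  toFun := physV P Ω k g₀ hh j
  map_add' v v' := (physV_add P Ω k g₀ hh j v v').symm
  map_smul' := physV_smul P Ω k g₀ hh j

/-- `physV` as a bounded linear map (crude bound `|𝗐_{g,j}| + |𝗐_{z,j}|`). [cite: BauerschmidtBrydgesSlade2015Flow, §3.2, (3.1)–(3.2)] -/
def physVL (P : QuadFlowParams) (Ω : ℝ) (k : ℕ∞) (g₀ hh : ℝ) (j : ℕ) : V3 →L[ℝ] V3 :=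
  (physVLin P Ω k g₀ hh j).mkContinuous (|P.wG g₀ hh j| + |P.wZ g₀ Ω k hh j|) fun v => by
    have hv : ∀ i, |v i| ≤ ‖v‖ := fun i => QuadFlowParams.abs_apply_le_norm v i
    have h0 : 0 ≤ (|P.wG g₀ hh j| + |P.wZ g₀ Ω k hh j|) * ‖v‖ := by positivity
    refine norm_V3_le h0 ?_ ?_ ?_
    · show |physV P Ω k g₀ hh j v 0| ≤ _
      rw [physV_apply_zero, abs_mul]
      calc |P.wG g₀ hh j| * |v 0| ≤ |P.wG g₀ hh j| * ‖v‖ := by gcongr; exact hv 0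
        _ ≤ _ := by nlinarith [abs_nonneg (P.wZ g₀ Ω k hh j), norm_nonneg v]
    · show |physV P Ω k g₀ hh j v 1| ≤ _
      rw [physV_apply_one, abs_mul]
      calc |P.wZ g₀ Ω k hh j| * |v 1| ≤ |P.wZ g₀ Ω k hh j| * ‖v‖ := by gcongr; exact hv 1
        _ ≤ _ := by nlinarith [abs_nonneg (P.wG g₀ hh j), norm_nonneg v]
    · show |physV P Ω k g₀ hh j v 2| ≤ _
      rw [physV_apply_two, abs_mul]
      calc |P.wZ g₀ Ω k hh j| * |v 2| ≤ |P.wZ g₀ Ω k hh j| * ‖v‖ := by gcongr; exact hv 2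
        _ ≤ _ := by nlinarith [abs_nonneg (P.wG g₀ hh j), norm_nonneg v]

/-- `physVL` is `physV`. [cite: BauerschmidtBrydgesSlade2015Flow, §3.2, (3.1)] -/
@[simp] theorem physVL_apply (P : QuadFlowParams) (Ω : ℝ) (k : ℕ∞) (g₀ hh : ℝ) (j : ℕ) (v : V3) :
    physVL P Ω k g₀ hh j v = physV P Ω k g₀ hh j v := rfl

/-- The linear part `(K̃, Ṽ) ↦ (𝗐_{K,j}K̃, 𝗐_V·Ṽ)` of the affine map `ỹ ↦ x_j(ỹ)`.
[cite: BauerschmidtBrydgesSlade2015Flow, §3.2, (3.1)–(3.2)] -/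
def physXL (P : QuadFlowParams) (Ω : ℝ) (k : ℕ∞) (g₀ hh aK : ℝ) (j : ℕ) : (W j × V3) →L[ℝ] (W j × V3) :=
  (P.wK g₀ Ω k aK j • ContinuousLinearMap.fst ℝ (W j) V3).prod
    (physVL P Ω k g₀ hh j ∘L ContinuousLinearMap.snd ℝ (W j) V3)

/-- `physXL (K̃, Ṽ) = (𝗐_K K̃, 𝗐_V·Ṽ)`. [cite: BauerschmidtBrydgesSlade2015Flow, §3.2, (3.1)] -/
@[simp] theorem physXL_apply (P : QuadFlowParams) (Ω : ℝ) (k : ℕ∞) (g₀ hh aK : ℝ) (j : ℕ) (y : W j × V3) :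
    physXL P Ω k g₀ hh aK j y = (P.wK g₀ Ω k aK j • y.1, physV P Ω k g₀ hh j y.2) := rfl

/-- `x_j(ỹ) = x̄_j + physXL ỹ`. [cite: BauerschmidtBrydgesSlade2015Flow, §3.2 ("x ∈ x̄ + 𝔹")] -/
theorem physX_eq_baseX_add (P : QuadFlowParams) (ψ : ∀ j, W j × V3 → W (j + 1)) (Ω : ℝ) (k : ℕ∞)
    (g₀ hh aK : ℝ) (K₀ : W 0) (j : ℕ) (y : W j × V3) :
    physX P ψ Ω k g₀ hh aK K₀ j y = baseX P ψ g₀ K₀ j + physXL P Ω k g₀ hh aK j y := rfl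

/-- The affine map `ỹ ↦ x_j(ỹ)` is strictly differentiable with derivative `physXL`. [cite: BauerschmidtBrydgesSlade2015Flow, §3.2] -/
theorem hasStrictFDerivAt_physX (P : QuadFlowParams) (ψ : ∀ j, W j × V3 → W (j + 1)) (Ω : ℝ) (k : ℕ∞)
    (g₀ hh aK : ℝ) (K₀ : W 0) (j : ℕ) (y : W j × V3) :
    HasStrictFDerivAt (physX P ψ Ω k g₀ hh aK K₀ j) (physXL P Ω k g₀ hh aK j) y := by
  have : physX P ψ Ω k g₀ hh aK K₀ j = fun y => baseX P ψ g₀ K₀ j + physXL P Ω k g₀ hh aK j y :=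
    funext (physX_eq_baseX_add P ψ Ω k g₀ hh aK K₀ j)
  rw [this]
  exact ((physXL (W := W) P Ω k g₀ hh aK j).hasStrictFDerivAt).const_add _

/-- The affine map `ỹ ↦ x_j(ỹ)` is differentiable with derivative `physXL`. [cite: BauerschmidtBrydgesSlade2015Flow, §3.2] -/
theorem hasFDerivAt_physX (P : QuadFlowParams) (ψ : ∀ j, W j × V3 → W (j + 1)) (Ω : ℝ) (k : ℕ∞)
    (g₀ hh aK : ℝ) (K₀ : W 0) (j : ℕ) (y : W j × V3) :
    HasFDerivAt (physX P ψ Ω k g₀ hh aK K₀ j) (physXL P Ω k g₀ hh aK j) y :=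
  (hasStrictFDerivAt_physX P ψ Ω k g₀ hh aK K₀ j y).hasFDerivAt

/-- **The one-scale `𝒦`-map of `T`**: `stepK_j(ỹ) = 𝗐_{K,j+1}⁻¹[ψ_j(x_j(ỹ)) - ψ_j(x̄_j)]`, so that
`(T^K ỹ)_{j+1} = stepK_j(ỹ_j)`. [cite: BauerschmidtBrydgesSlade2015Flow, §3.1, (3.3)–(3.4) and §3.3, (3.8)] -/
def stepK (P : QuadFlowParams) (ψ : ∀ j, W j × V3 → W (j + 1)) (Ω : ℝ) (k : ℕ∞) (g₀ hh aK : ℝ)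
    (K₀ : W 0) (j : ℕ) (y : W j × V3) : W (j + 1) :=
  (P.wK g₀ Ω k aK (j + 1))⁻¹ • (ψ j (physX P ψ Ω k g₀ hh aK K₀ j y) - ψ j (baseX P ψ g₀ K₀ j))

/-- **The one-scale source map of `T`**: `stepN_j(ỹ) = 𝗏_{V,j+1}⁻¹[Q_j(𝗐_V·Ṽ) + ρ_j(x_j(ỹ))]`, so that
`Ñ_{j+1}(ỹ) = stepN_j(ỹ_j)`. [cite: BauerschmidtBrydgesSlade2015Flow, §3.3, (3.8) and §4.1] -/
def stepN (P : QuadFlowParams) (ψ : ∀ j, W j × V3 → W (j + 1)) (ρ : ∀ j, W j × V3 → V3) (Ω : ℝ) (k : ℕ∞)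
    (g₀ hh aK : ℝ) (K₀ : W 0) (j : ℕ) (y : W j × V3) : V3 :=
  (P.vV g₀ Ω k hh (j + 1))⁻¹ •
    (P.quadRem j (P.flow g₀ j) (physV P Ω k g₀ hh j y.2) + ρ j (physX P ψ Ω k g₀ hh aK K₀ j y))

/-- `(T^K ỹ)_{j+1} = stepK_j(ỹ_j)`. [cite: BauerschmidtBrydgesSlade2015Flow, §3.3, (3.8)] -/
theorem TK_succ_eq_stepK (P : QuadFlowParams) (ψ : ∀ j, W j × V3 → W (j + 1)) (Ω : ℝ) (k : ℕ∞)
    (g₀ hh aK : ℝ) (K₀ : W 0) (y : (∀ j, W j) × (ℕ → V3)) (j : ℕ) :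
    TK P ψ Ω k g₀ hh aK K₀ y (j + 1) = stepK P ψ Ω k g₀ hh aK K₀ j (y.1 j, y.2 j) := rfl

/-- `Ñ_{j+1}(ỹ) = stepN_j(ỹ_j)`. [cite: BauerschmidtBrydgesSlade2015Flow, §3.3, (3.8)] -/
theorem srcN_succ_eq_stepN (P : QuadFlowParams) (ψ : ∀ j, W j × V3 → W (j + 1)) (ρ : ∀ j, W j × V3 → V3)
    (Ω : ℝ) (k : ℕ∞) (g₀ hh aK : ℝ) (K₀ : W 0) (y : (∀ j, W j) × (ℕ → V3)) (j : ℕ) :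
    srcN P ψ ρ Ω k g₀ hh aK K₀ y (j + 1) = stepN P ψ ρ Ω k g₀ hh aK K₀ j (y.1 j, y.2 j) := rfl

/-- `stepK_j(0) = 0`. [cite: BauerschmidtBrydgesSlade2015Flow, §3.1, (3.3)] -/
@[simp] theorem stepK_zero (P : QuadFlowParams) (ψ : ∀ j, W j × V3 → W (j + 1)) (Ω : ℝ) (k : ℕ∞)
    (g₀ hh aK : ℝ) (K₀ : W 0) (j : ℕ) : stepK P ψ Ω k g₀ hh aK K₀ j 0 = 0 := by
  simp [stepK]

/-- The Fréchet derivative of `stepK_j` at `ỹ`: `𝗐_{K,j+1}⁻¹Dψ_j(x_j(ỹ)) ∘ physXL`.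
[cite: BauerschmidtBrydgesSlade2015Flow, Lemma 3.3, (3.10) and (3.12)] -/
def stepKDeriv (P : QuadFlowParams) (ψ : ∀ j, W j × V3 → W (j + 1)) (Ω : ℝ) (k : ℕ∞) (g₀ hh aK : ℝ)
    (K₀ : W 0) (j : ℕ) (y : W j × V3) : (W j × V3) →L[ℝ] W (j + 1) :=
  (P.wK g₀ Ω k aK (j + 1))⁻¹ • (fderiv ℝ (ψ j) (physX P ψ Ω k g₀ hh aK K₀ j y) ∘L physXL P Ω k g₀ hh aK j)

/-- The Fréchet derivative of `stepN_j` at `ỹ`: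
`𝗏_{V,j+1}⁻¹([Dφ̄_j(V̄_j + 𝗐_VṼ) - Dφ̄_j(V̄_j)] ∘ 𝗐_V ∘ π_V + Dρ_j(x_j(ỹ)) ∘ physXL)`.
[cite: BauerschmidtBrydgesSlade2015Flow, Lemma 3.3, (3.10)–(3.11) and §4.1, (4.2)] -/
def stepNDeriv (P : QuadFlowParams) (ψ : ∀ j, W j × V3 → W (j + 1)) (ρ : ∀ j, W j × V3 → V3) (Ω : ℝ) (k : ℕ∞)
    (g₀ hh aK : ℝ) (K₀ : W 0) (j : ℕ) (y : W j × V3) : (W j × V3) →L[ℝ] V3 :=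
  (P.vV g₀ Ω k hh (j + 1))⁻¹ •
    ((P.dmap j (P.flow g₀ j + physV P Ω k g₀ hh j y.2) - P.dmap j (P.flow g₀ j)) ∘L
        (physVL P Ω k g₀ hh j ∘L ContinuousLinearMap.snd ℝ (W j) V3) +
      fderiv ℝ (ρ j) (physX P ψ Ω k g₀ hh aK K₀ j y) ∘L physXL P Ω k g₀ hh aK j)

/-- The quadratic remainder is differentiable: `D_y Q_j(V̄; y) = Dφ̄_j(V̄ + y) - Dφ̄_j(V̄)`.
[cite: BauerschmidtBrydgesSlade2015Flow, §4.1, (4.2)] -/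
theorem hasFDerivAt_quadRem (P : QuadFlowParams) (j : ℕ) (Vb y : V3) :
    HasFDerivAt (P.quadRem j Vb) (P.dmap j (Vb + y) - P.dmap j Vb) y := by
  have h1 : HasFDerivAt (fun y : V3 => P.map j (Vb + y)) (P.dmap j (Vb + y)) y := by
    have := (P.hasFDerivAt_map j (Vb + y)).comp y ((hasFDerivAt_id (𝕜 := ℝ) y).const_add Vb)
    simpa using this
  exact (h1.sub_const (P.map j Vb)).sub (P.dmap j Vb).hasFDerivAt

end OneScale

/-! ## A real-arithmetic form of "`‖D²φ‖_{L²(X^𝗐,X^𝗏)} ≤ C`": the four weighted second-order terms -/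

/-- The weighted sum of the four order-two terms of (1.13) against the weights `𝗐_K ≤ ϑa_KA`,
`𝗐_V ≤ 8𝗁Bq` is at most `MA(ϑa_K + 8𝗁)²‖δ‖‖d‖`. [cite: BauerschmidtBrydgesSlade2015Flow, Lemma 3.3, (3.12)–(3.13)] -/
theorem weighted_second_order_le {M A Bq wK wG ϑ aK hh kδ vδ kd vd n m : ℝ} (hM : 0 ≤ M) (hA : 0 < A)
    (hBq : 0 < Bq) (hϑaK : 0 ≤ ϑ * aK) (hh0 : 0 ≤ hh) (hn : 0 ≤ n) (hm : 0 ≤ m)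
    (hkd0 : 0 ≤ kd) (hvd0 : 0 ≤ vd)
    (hkδ : kδ ≤ wK * n) (hvδ : vδ ≤ wG * n) (hkd : kd ≤ wK * m) (hvd : vd ≤ wG * m)
    (hwK : wK ≤ ϑ * aK * A) (hwG : wG ≤ 8 * hh * Bq) :
    M * (A⁻¹ * (kδ * kd) + Bq⁻¹ * (kδ * vd) + Bq⁻¹ * (vδ * kd) + A * (Bq ^ 2)⁻¹ * (vδ * vd)) ≤
      M * A * (ϑ * aK + 8 * hh) ^ 2 * (n * m) := by
  have hK1 : kδ ≤ ϑ * aK * A * n := hkδ.trans (mul_le_mul_of_nonneg_right hwK hn)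
  have hK2 : kd ≤ ϑ * aK * A * m := hkd.trans (mul_le_mul_of_nonneg_right hwK hm)
  have hV1 : vδ ≤ 8 * hh * Bq * n := hvδ.trans (mul_le_mul_of_nonneg_right hwG hn)
  have hV2 : vd ≤ 8 * hh * Bq * m := hvd.trans (mul_le_mul_of_nonneg_right hwG hm)
  have hKn : 0 ≤ ϑ * aK * A * n := by positivity
  have hVn : 0 ≤ 8 * hh * Bq * n := by positivity
  have p1 : kδ * kd ≤ (ϑ * aK * A * n) * (ϑ * aK * A * m) := mul_le_mul hK1 hK2 hkd0 hKn
  have p2 : kδ * vd ≤ (ϑ * aK * A * n) * (8 * hh * Bq * m) := mul_le_mul hK1 hV2 hvd0 hKn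
  have p3 : vδ * kd ≤ (8 * hh * Bq * n) * (ϑ * aK * A * m) := mul_le_mul hV1 hK2 hkd0 hVn
  have p4 : vδ * vd ≤ (8 * hh * Bq * n) * (8 * hh * Bq * m) := mul_le_mul hV1 hV2 hvd0 hVn
  have hAi : 0 ≤ A⁻¹ := inv_nonneg.2 hA.le
  have hBi : 0 ≤ Bq⁻¹ := inv_nonneg.2 hBq.le
  have hB2i : 0 ≤ A * (Bq ^ 2)⁻¹ := by positivity
  calc M * (A⁻¹ * (kδ * kd) + Bq⁻¹ * (kδ * vd) + Bq⁻¹ * (vδ * kd) + A * (Bq ^ 2)⁻¹ * (vδ * vd))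
      ≤ M * (A⁻¹ * ((ϑ * aK * A * n) * (ϑ * aK * A * m)) + Bq⁻¹ * ((ϑ * aK * A * n) * (8 * hh * Bq * m)) +
          Bq⁻¹ * ((8 * hh * Bq * n) * (ϑ * aK * A * m)) + A * (Bq ^ 2)⁻¹ * ((8 * hh * Bq * n) * (8 * hh * Bq * m))) := by
        gcongr
    _ = M * A * (ϑ * aK + 8 * hh) ^ 2 * (n * m) := by
        field_simp
        ring

/-! ## The one-scale estimates: interior points, derivatives, first- and second-order bounds -/

section UnitBox

variable {E₁ E₂ : Type*} [NormedAddCommGroup E₁] [NormedAddCommGroup E₂]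

/-- The closed unit box is a neighbourhood of a point of the open unit box. [folklore] -/
theorem closedBox_mem_nhds {y : E₁ × E₂} (hy1 : ‖y.1‖ < 1) (hy2 : ‖y.2‖ < 1) :
    {z : E₁ × E₂ | ‖z.1‖ ≤ 1 ∧ ‖z.2‖ ≤ 1} ∈ 𝓝 y := by
  have hy : ‖y‖ < 1 := by rw [Prod.norm_def]; exact max_lt hy1 hy2
  have hball : Metric.ball (0 : E₁ × E₂) 1 ∈ 𝓝 y := Metric.isOpen_ball.mem_nhds (by simpa using hy)
  refine Filter.mem_of_superset hball fun z hz => ?_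
  rw [mem_ball_zero_iff, Prod.norm_def, max_lt_iff] at hz
  exact ⟨hz.1.le, hz.2.le⟩

/-- Components of a point of the open unit ball. [folklore] -/
theorem norm_fst_snd_lt_of_norm_lt {y : E₁ × E₂} (hy : ‖y‖ < 1) : ‖y.1‖ < 1 ∧ ‖y.2‖ < 1 := by
  rw [Prod.norm_def, max_lt_iff] at hy; exact hy

end UnitBox


section OneScaleEstimates

namespace CutoffQuadHyp

variable {P : QuadFlowParams} {Ω : ℝ} {k : ℕ∞} {B c : ℝ} {N : ℕ} {C lam g₀ : ℝ}
  (h : CutoffQuadHyp P Ω k B c N C lam g₀)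
include h

/-- `|log g̊_j| ≤ 2|log g̊_{j+1}|` (`g̊_{j+1} ≤ (3/2)g̊_j` and `|log g̊_{j+1}| ≥ 1/2`).
[cite: BauerschmidtBrydgesSlade2015Flow, Lemma 2.1(i)–(ii)(a), (2.2)] -/
theorem abs_log_gbar_le_two_mul_succ (j : ℕ) :
    |Real.log (gbar P.β g₀ j)| ≤ 2 * |Real.log (gbar P.β g₀ (j + 1))| := by
  have h1 := h.neg_half_le_log_div j
  have h2 := h.half_le_abs_log_gbar (j + 1)
  rw [Real.log_div (h.gbar_pos j).ne' (h.gbar_pos (j + 1)).ne'] at h1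
  rw [h.abs_log_gbar] at h2 ⊢
  rw [h.abs_log_gbar]
  linarith

/-- `𝗐_{g,j} ≤ 8𝗁·g̊_{j+1}²|log g̊_{j+1}|` (`g̊_j ≤ 2g̊_{j+1}`, `|log g̊_j| ≤ 2|log g̊_{j+1}|`).
[cite: BauerschmidtBrydgesSlade2015Flow, Lemma 3.3, (3.12) (the weights are comparable along one step)] -/
theorem wG_le_eight_mul_succ {hh : ℝ} (hh0 : 0 ≤ hh) (j : ℕ) :
    P.wG g₀ hh j ≤ 8 * hh * (gbar P.β g₀ (j + 1) ^ 2 * |Real.log (gbar P.β g₀ (j + 1))|) := by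
  have hg2 : gbar P.β g₀ j ≤ 2 * gbar P.β g₀ (j + 1) := by linarith [(h.gbar_succ_mem j).1]
  have hl := h.abs_log_gbar_le_two_mul_succ j
  have hg := (h.gbar_pos j).le
  have hL : 0 ≤ |Real.log (gbar P.β g₀ (j + 1))| := abs_nonneg _
  unfold QuadFlowParams.wG
  calc hh * (gbar P.β g₀ j ^ 2 * |Real.log (gbar P.β g₀ j)|)
      ≤ hh * ((2 * gbar P.β g₀ (j + 1)) ^ 2 * (2 * |Real.log (gbar P.β g₀ (j + 1))|)) := by gcongr
    _ = _ := by ring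

variable {W : ℕ → Type*} [∀ j, NormedAddCommGroup (W j)] [∀ j, NormedSpace ℝ (W j)]
  {ψ : ∀ j, W j × V3 → W (j + 1)} {ρ : ∀ j, W j × V3 → V3} {a hh κ R M aStar b : ℝ} {K₀ : W 0}

/-- `‖physV ỹ^V‖`-type bound through the bounded linear map: `‖physVL‖ ≤ 2𝗐_{g,j}`.
[cite: BauerschmidtBrydgesSlade2015Flow, §3.2, (3.2)] -/
theorem norm_physVL_le (hh0 : 0 < hh) (j : ℕ) : ‖physVL P Ω k g₀ hh j‖ ≤ 2 * P.wG g₀ hh j := by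
  have hG := (h.wG_pos hh0 j).le
  have hZ := (h.wZ_pos hh0 (k := k) (Ω := Ω) j).le
  have hZG := h.wZ_le_wG hh0.le j
  refine (LinearMap.mkContinuous_norm_le _ (by positivity) _).trans ?_
  rw [abs_of_nonneg hG, abs_of_nonneg hZ]
  linarith

/-- **Points of the open unit ball lie over the INTERIOR of `D_j`**: for `‖K̃‖ < 1`, `‖Ṽ‖ < 1` the
physical point `x_j(ỹ)` is an interior point of `D_j(g₀, a, 𝗁)` (strict inequalities in (1.10), as
`a_* < a`, `χ_j, g̊_j, |log g̊_j| > 0`). [cite: BauerschmidtBrydgesSlade2015Flow, §3.2 (the ball projects into D_j)] -/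
theorem physX_mem_nhds (hB : BallHyp P ψ Ω k g₀ hh a aStar b K₀) (j : ℕ) {y : W j × V3}
    (hy1 : ‖y.1‖ < 1) (hy2 : ‖y.2‖ < 1) :
    flowDomain (cutoffWeight Ω k) (P.flow g₀) a hh j ∈ 𝓝 (physX P ψ Ω k g₀ hh (a - aStar) K₀ j y) := by
  have hw := h.weight_pos j; have hg := h.gbar_pos j; have hh0 := hB.hh_pos
  have haK : 0 < a - aStar := by linarith [hB.aStar_lt]
  have hL : 0 < |Real.log (gbar P.β g₀ j)| := by linarith [h.half_le_abs_log_gbar j]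
  have hv : ∀ i, |y.2 i| < 1 := fun i => (QuadFlowParams.abs_apply_le_norm y.2 i).trans_lt hy2
  have hG0 : 0 < P.wG g₀ hh j := h.wG_pos hh0 j
  have hZ0 : 0 < P.wZ g₀ Ω k hh j := h.wZ_pos hh0 j
  refine flowDomain_mem_nhds_of_lt ?_ ?_ ?_ ?_
  · simp only [physX, QuadFlowParams.flow_apply_zero]
    have hpos : 0 < (a - aStar) * (cutoffWeight Ω k j * gbar P.β g₀ j ^ 3) := by positivity
    calc ‖Kbar ψ (P.flow g₀) K₀ j + P.wK g₀ Ω k (a - aStar) j • y.1‖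
        ≤ ‖Kbar ψ (P.flow g₀) K₀ j‖ + ‖P.wK g₀ Ω k (a - aStar) j • y.1‖ := norm_add_le _ _
      _ ≤ aStar * cutoffWeight Ω k j * gbar P.β g₀ j ^ 3 +
            (a - aStar) * (cutoffWeight Ω k j * gbar P.β g₀ j ^ 3) * ‖y.1‖ := by
          refine add_le_add (hB.Kbar_le j) ?_
          rw [norm_smul, Real.norm_eq_abs, QuadFlowParams.wK, abs_of_nonneg hpos.le]
      _ < aStar * cutoffWeight Ω k j * gbar P.β g₀ j ^ 3 +
            (a - aStar) * (cutoffWeight Ω k j * gbar P.β g₀ j ^ 3) * 1 := by gcongr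
      _ = a * cutoffWeight Ω k j * gbar P.β g₀ j ^ 3 := by ring
  · simp only [physX, Pi.add_apply, physV_apply_zero, QuadFlowParams.flow_apply_zero, add_sub_cancel_left]
    rw [abs_mul, abs_of_pos hG0]
    calc P.wG g₀ hh j * |y.2 0| < P.wG g₀ hh j * 1 := by gcongr; exact hv 0
      _ = hh * gbar P.β g₀ j ^ 2 * |Real.log (gbar P.β g₀ j)| := by unfold QuadFlowParams.wG; ring
  · simp only [physX, Pi.add_apply, physV_apply_one, QuadFlowParams.flow_apply_zero, add_sub_cancel_left]
    rw [abs_mul, abs_of_pos hZ0]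
    calc P.wZ g₀ Ω k hh j * |y.2 1| < P.wZ g₀ Ω k hh j * 1 := by gcongr; exact hv 1
      _ = hh * cutoffWeight Ω k j * gbar P.β g₀ j ^ 2 * |Real.log (gbar P.β g₀ j)| := by
          unfold QuadFlowParams.wZ; ring
  · simp only [physX, Pi.add_apply, physV_apply_two, QuadFlowParams.flow_apply_zero, add_sub_cancel_left]
    rw [abs_mul, abs_of_pos hZ0]
    calc P.wZ g₀ Ω k hh j * |y.2 2| < P.wZ g₀ Ω k hh j * 1 := by gcongr; exact hv 2
      _ = hh * cutoffWeight Ω k j * gbar P.β g₀ j ^ 2 * |Real.log (gbar P.β g₀ j)| := by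
          unfold QuadFlowParams.wZ; ring

/-- Points of the closed unit ball lie over `D_j`. [cite: BauerschmidtBrydgesSlade2015Flow, §3.2] -/
theorem physX_mem_of_le_one (hB : BallHyp P ψ Ω k g₀ hh a aStar b K₀) (j : ℕ) {y : W j × V3}
    (hy1 : ‖y.1‖ ≤ 1) (hy2 : ‖y.2‖ ≤ 1) :
    physX P ψ Ω k g₀ hh (a - aStar) K₀ j y ∈ flowDomain (cutoffWeight Ω k) (P.flow g₀) a hh j :=
  h.physX_mem_flowDomain hB.hh_pos.le le_rfl (by linarith [hB.aStar_lt]) (by linarith) j (hB.Kbar_le j) hy1 hy2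

/-- `D_j` has the unique differentiability property (convex with an interior point).
[cite: BauerschmidtBrydgesSlade2015Flow, §1.3, (1.10)] -/
theorem uniqueDiffOn_flowDomain (hB : BallHyp P ψ Ω k g₀ hh a aStar b K₀) (j : ℕ) :
    UniqueDiffOn ℝ (flowDomain (E := W j) (cutoffWeight Ω k) (P.flow g₀) a hh j) :=
  uniqueDiffOn_convex (convex_flowDomain _ _ _ _ j)
    ⟨physX P ψ Ω k g₀ hh (a - aStar) K₀ j 0, mem_interior_iff_mem_nhds.2
      (h.physX_mem_nhds hB j (y := 0) (by simp) (by simp))⟩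

/-- **`stepK_j` is differentiable on the open unit ball** with derivative `stepKDeriv` (chain rule; `ψ_j`
is `C³` at the interior point `x_j(ỹ)` by (A3)). [cite: BauerschmidtBrydgesSlade2015Flow, Lemma 3.3 ("φ is twice continuously Fréchet differentiable")] -/
theorem hasFDerivAt_stepK (hA : HypA3 (cutoffWeight Ω k) ψ ρ (P.flow g₀) a hh κ Ω R M)
    (hB : BallHyp P ψ Ω k g₀ hh a aStar b K₀) (j : ℕ) {y : W j × V3} (hy1 : ‖y.1‖ < 1) (hy2 : ‖y.2‖ < 1) :
    HasFDerivAt (stepK P ψ Ω k g₀ hh (a - aStar) K₀ j) (stepKDeriv P ψ Ω k g₀ hh (a - aStar) K₀ j y) y := by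
  have hψ : HasFDerivAt (ψ j) (fderiv ℝ (ψ j) (physX P ψ Ω k g₀ hh (a - aStar) K₀ j y))
      (physX P ψ Ω k g₀ hh (a - aStar) K₀ j y) :=
    (((hA.contDiffOn_ψ j).contDiffAt (h.physX_mem_nhds hB j hy1 hy2)).differentiableAt (by norm_num)).hasFDerivAt
  have hc := hψ.comp y (hasFDerivAt_physX P ψ Ω k g₀ hh (a - aStar) K₀ j y)
  exact (hc.sub_const (ψ j (baseX P ψ g₀ K₀ j))).const_smul ((P.wK g₀ Ω k (a - aStar) (j + 1))⁻¹)

/-- **`stepN_j` is differentiable on the open unit ball** with derivative `stepNDeriv`.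
[cite: BauerschmidtBrydgesSlade2015Flow, Lemma 3.3 and §4.1, (4.2)] -/
theorem hasFDerivAt_stepN (hA : HypA3 (cutoffWeight Ω k) ψ ρ (P.flow g₀) a hh κ Ω R M)
    (hB : BallHyp P ψ Ω k g₀ hh a aStar b K₀) (j : ℕ) {y : W j × V3} (hy1 : ‖y.1‖ < 1) (hy2 : ‖y.2‖ < 1) :
    HasFDerivAt (stepN P ψ ρ Ω k g₀ hh (a - aStar) K₀ j) (stepNDeriv P ψ ρ Ω k g₀ hh (a - aStar) K₀ j y) y := by
  have hρ : HasFDerivAt (ρ j) (fderiv ℝ (ρ j) (physX P ψ Ω k g₀ hh (a - aStar) K₀ j y))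
      (physX P ψ Ω k g₀ hh (a - aStar) K₀ j y) :=
    (((hA.contDiffOn_ρ j).contDiffAt (h.physX_mem_nhds hB j hy1 hy2)).differentiableAt (by norm_num)).hasFDerivAt
  have hc := hρ.comp y (hasFDerivAt_physX P ψ Ω k g₀ hh (a - aStar) K₀ j y)
  have hV : HasFDerivAt (fun y : W j × V3 => physV P Ω k g₀ hh j y.2)
      (physVL P Ω k g₀ hh j ∘L ContinuousLinearMap.snd ℝ (W j) V3) y :=
    (physVL P Ω k g₀ hh j ∘L ContinuousLinearMap.snd ℝ (W j) V3).hasFDerivAt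
  have hQ := (hasFDerivAt_quadRem P j (P.flow g₀ j) (physV P Ω k g₀ hh j y.2)).comp y hV
  exact (hQ.add hc).const_smul ((P.vV g₀ Ω k hh (j + 1))⁻¹)

/-- `stepK_j` is `lipK`-Lipschitz on the closed unit ball (Lemma 3.3, first derivatives, in scaled
coordinates). [cite: BauerschmidtBrydgesSlade2015Flow, Lemma 3.3, (3.10)] -/
theorem norm_stepK_sub_stepK_le (hA : HypA3 (cutoffWeight Ω k) ψ ρ (P.flow g₀) a hh κ Ω R M)
    (hB : BallHyp P ψ Ω k g₀ hh a aStar b K₀) (j : ℕ) {y y' : W j × V3}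
    (hy1 : ‖y.1‖ ≤ 1) (hy2 : ‖y.2‖ ≤ 1) (hy1' : ‖y'.1‖ ≤ 1) (hy2' : ‖y'.2‖ ≤ 1) :
    ‖stepK P ψ Ω k g₀ hh (a - aStar) K₀ j y - stepK P ψ Ω k g₀ hh (a - aStar) K₀ j y'‖ ≤
      lipK Ω B g₀ κ M hh (a - aStar) * ‖y - y'‖ := by
  have haK : 0 < a - aStar := by linarith [hB.aStar_lt]
  have hst := h.norm_stepK_sub_le hA hB.small1 hB.hh_pos haK j (h.physX_mem_of_le_one hB j hy1 hy2)
    (h.physX_mem_of_le_one hB j hy1' hy2')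
  have hc1 : 0 ≤ κ * stepRatio Ω B g₀ := mul_nonneg hA.κ_pos.le h.stepRatio_nonneg
  have hc2 : 0 ≤ 4 * M * epsLog g₀ * hh / (a - aStar) := by
    have := hA.M_pos.le; have := h.epsLog_nonneg; have := hB.hh_pos.le; positivity
  have n1 : ‖y.1 - y'.1‖ ≤ ‖y - y'‖ := by rw [← Prod.fst_sub]; exact norm_fst_le _
  have n2 : ‖y.2 - y'.2‖ ≤ ‖y - y'‖ := by rw [← Prod.snd_sub]; exact norm_snd_le _
  calc _ ≤ κ * stepRatio Ω B g₀ * ‖y.1 - y'.1‖ + 4 * M * epsLog g₀ * hh / (a - aStar) * ‖y.2 - y'.2‖ := hst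
    _ ≤ κ * stepRatio Ω B g₀ * ‖y - y'‖ + 4 * M * epsLog g₀ * hh / (a - aStar) * ‖y - y'‖ := by gcongr
    _ = _ := by unfold lipK; ring

/-- `stepN_j` is `lipN(b := 1)`-Lipschitz on the closed unit ball. [cite: BauerschmidtBrydgesSlade2015Flow, Lemma 3.3, (3.10)–(3.11)] -/
theorem norm_stepN_sub_stepN_le (hA : HypA3 (cutoffWeight Ω k) ψ ρ (P.flow g₀) a hh κ Ω R M)
    (hB : BallHyp P ψ Ω k g₀ hh a aStar b K₀) (j : ℕ) {y y' : W j × V3}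
    (hy1 : ‖y.1‖ ≤ 1) (hy2 : ‖y.2‖ ≤ 1) (hy1' : ‖y'.1‖ ≤ 1) (hy2' : ‖y'.2‖ ≤ 1) :
    ‖stepN P ψ ρ Ω k g₀ hh (a - aStar) K₀ j y - stepN P ψ ρ Ω k g₀ hh (a - aStar) K₀ j y'‖ ≤
      lipN Ω B C g₀ M hh (a - aStar) 1 * ‖y - y'‖ := by
  have haK : 0 ≤ a - aStar := by linarith [hB.aStar_lt]
  have hst := h.norm_stepN_sub_le hA hB.small1 hB.small2 hB.hh_pos haK zero_le_one j
    (h.physX_mem_of_le_one hB j hy1 hy2) (h.physX_mem_of_le_one hB j hy1' hy2') hy2 hy2'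
  have hM := hA.M_pos.le; have hε1 := h.epsLog_nonneg; have hε2 := h.epsLogSq_nonneg; have hϑ := h.stepRatio_nonneg
  have hh0 := hB.hh_pos.le
  have hBC : 0 ≤ 2 * B + 14 * C := by have := h.B_nonneg; have := h.C_nonneg; positivity
  have hΩ : 0 ≤ Ω := by linarith [h.one_lt]
  have hc1 : 0 ≤ M * (a - aStar) * stepRatio Ω B g₀ / hh := by positivity
  have hc2 : 0 ≤ 8 * (2 * B + 14 * C) * Ω * epsLogSq g₀ * hh * 1 + 4 * M * epsLog g₀ := by positivity
  have n1 : ‖y.1 - y'.1‖ ≤ ‖y - y'‖ := by rw [← Prod.fst_sub]; exact norm_fst_le _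
  have n2 : ‖y.2 - y'.2‖ ≤ ‖y - y'‖ := by rw [← Prod.snd_sub]; exact norm_snd_le _
  calc _ ≤ M * (a - aStar) * stepRatio Ω B g₀ / hh * ‖y.1 - y'.1‖ +
        (8 * (2 * B + 14 * C) * Ω * epsLogSq g₀ * hh * 1 + 4 * M * epsLog g₀) * ‖y.2 - y'.2‖ := hst
    _ ≤ M * (a - aStar) * stepRatio Ω B g₀ / hh * ‖y - y'‖ +
        (8 * (2 * B + 14 * C) * Ω * epsLogSq g₀ * hh * 1 + 4 * M * epsLog g₀) * ‖y - y'‖ := by gcongr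
    _ = _ := by unfold lipN; ring

/-- `‖stepK_j(ỹ)‖ ≤ lipK` on the closed unit ball. [cite: BauerschmidtBrydgesSlade2015Flow, Lemma 3.3, (3.10)] -/
theorem norm_stepK_le' (hA : HypA3 (cutoffWeight Ω k) ψ ρ (P.flow g₀) a hh κ Ω R M)
    (hB : BallHyp P ψ Ω k g₀ hh a aStar b K₀) (j : ℕ) {y : W j × V3} (hy1 : ‖y.1‖ ≤ 1) (hy2 : ‖y.2‖ ≤ 1) :
    ‖stepK P ψ Ω k g₀ hh (a - aStar) K₀ j y‖ ≤ lipK Ω B g₀ κ M hh (a - aStar) := by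
  have := h.norm_stepK_sub_stepK_le hA hB j hy1 hy2 (y' := 0) (by simp) (by simp)
  rw [stepK_zero, sub_zero, sub_zero] at this
  refine this.trans ?_
  have hL := h.lipK_nonneg hA hB
  have hy : ‖y‖ ≤ 1 := by rw [Prod.norm_def]; exact max_le hy1 hy2
  calc lipK Ω B g₀ κ M hh (a - aStar) * ‖y‖ ≤ lipK Ω B g₀ κ M hh (a - aStar) * 1 := by gcongr
    _ = _ := mul_one _

/-- `‖stepN_j(ỹ)‖ ≤ M/𝗁 + lipN(1)` on the closed unit ball. [cite: BauerschmidtBrydgesSlade2015Flow, Lemma 3.3, (3.9)–(3.11)] -/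
theorem norm_stepN_le' (hA : HypA3 (cutoffWeight Ω k) ψ ρ (P.flow g₀) a hh κ Ω R M)
    (hB : BallHyp P ψ Ω k g₀ hh a aStar b K₀) (j : ℕ) {y : W j × V3} (hy1 : ‖y.1‖ ≤ 1) (hy2 : ‖y.2‖ ≤ 1) :
    ‖stepN P ψ ρ Ω k g₀ hh (a - aStar) K₀ j y‖ ≤ M / hh + lipN Ω B C g₀ M hh (a - aStar) 1 := by
  have hd := h.norm_stepN_sub_stepN_le hA hB j hy1 hy2 (y' := 0) (by simp) (by simp)
  have h0 : ‖stepN P ψ ρ Ω k g₀ hh (a - aStar) K₀ j 0‖ ≤ M / hh := by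
    have hx : baseX P ψ g₀ K₀ j ∈ flowDomain (cutoffWeight Ω k) (P.flow g₀) a hh j :=
      h.baseX_mem_flowDomain hB.hh_pos.le (by linarith [hB.aStar_lt]) j (hB.Kbar_le j)
    exact h.norm_stepN_zero_le hA hB.hh_pos (aK := a - aStar) (K₀ := K₀) j hx
  have hL := h.lipN_nonneg hA (hB := (⟨hB.hh_pos, zero_lt_one, le_rfl, hB.aStar_nonneg, hB.aStar_lt, hB.Kbar_le,
    hB.small1, hB.small2⟩ : BallHyp P ψ Ω k g₀ hh a aStar 1 K₀))
  have hy : ‖y‖ ≤ 1 := by rw [Prod.norm_def]; exact max_le hy1 hy2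
  rw [sub_zero] at hd
  calc ‖stepN P ψ ρ Ω k g₀ hh (a - aStar) K₀ j y‖
      ≤ ‖stepN P ψ ρ Ω k g₀ hh (a - aStar) K₀ j 0‖ +
          ‖stepN P ψ ρ Ω k g₀ hh (a - aStar) K₀ j y - stepN P ψ ρ Ω k g₀ hh (a - aStar) K₀ j 0‖ :=
        norm_le_insert' _ _
    _ ≤ M / hh + lipN Ω B C g₀ M hh (a - aStar) 1 * ‖y‖ := add_le_add h0 hd
    _ ≤ M / hh + lipN Ω B C g₀ M hh (a - aStar) 1 * 1 := by gcongr
    _ = _ := by rw [mul_one]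

/-- **`‖D stepK_j(ỹ)‖ ≤ lipK`** on the open unit ball (a derivative is bounded by a Lipschitz constant).
[cite: BauerschmidtBrydgesSlade2015Flow, Lemma 3.3, (3.10)] -/
theorem norm_stepKDeriv_le (hA : HypA3 (cutoffWeight Ω k) ψ ρ (P.flow g₀) a hh κ Ω R M)
    (hB : BallHyp P ψ Ω k g₀ hh a aStar b K₀) (j : ℕ) {y : W j × V3} (hy1 : ‖y.1‖ < 1) (hy2 : ‖y.2‖ < 1) :
    ‖stepKDeriv P ψ Ω k g₀ hh (a - aStar) K₀ j y‖ ≤ lipK Ω B g₀ κ M hh (a - aStar) := by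
  have hL := h.lipK_nonneg hA hB
  have hlip : LipschitzOnWith (Real.toNNReal (lipK Ω B g₀ κ M hh (a - aStar)))
      (stepK P ψ Ω k g₀ hh (a - aStar) K₀ j) {z : W j × V3 | ‖z.1‖ ≤ 1 ∧ ‖z.2‖ ≤ 1} :=
    LipschitzOnWith.of_dist_le_mul fun z hz z' hz' => by
      rw [dist_eq_norm, dist_eq_norm, Real.coe_toNNReal _ hL]
      exact h.norm_stepK_sub_stepK_le hA hB j hz.1 hz.2 hz'.1 hz'.2
  have := (h.hasFDerivAt_stepK hA hB j hy1 hy2).le_of_lipschitzOn (closedBox_mem_nhds hy1 hy2) hlip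
  rwa [Real.coe_toNNReal _ hL] at this

/-- **`‖D stepN_j(ỹ)‖ ≤ lipN(1)`** on the open unit ball. [cite: BauerschmidtBrydgesSlade2015Flow, Lemma 3.3, (3.10)–(3.11)] -/
theorem norm_stepNDeriv_le (hA : HypA3 (cutoffWeight Ω k) ψ ρ (P.flow g₀) a hh κ Ω R M)
    (hB : BallHyp P ψ Ω k g₀ hh a aStar b K₀) (j : ℕ) {y : W j × V3} (hy1 : ‖y.1‖ < 1) (hy2 : ‖y.2‖ < 1) :
    ‖stepNDeriv P ψ ρ Ω k g₀ hh (a - aStar) K₀ j y‖ ≤ lipN Ω B C g₀ M hh (a - aStar) 1 := by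
  have hL := h.lipN_nonneg hA (hB := (⟨hB.hh_pos, zero_lt_one, le_rfl, hB.aStar_nonneg, hB.aStar_lt, hB.Kbar_le,
    hB.small1, hB.small2⟩ : BallHyp P ψ Ω k g₀ hh a aStar 1 K₀))
  have hlip : LipschitzOnWith (Real.toNNReal (lipN Ω B C g₀ M hh (a - aStar) 1))
      (stepN P ψ ρ Ω k g₀ hh (a - aStar) K₀ j) {z : W j × V3 | ‖z.1‖ ≤ 1 ∧ ‖z.2‖ ≤ 1} :=
    LipschitzOnWith.of_dist_le_mul fun z hz z' hz' => by
      rw [dist_eq_norm, dist_eq_norm, Real.coe_toNNReal _ hL]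
      exact h.norm_stepN_sub_stepN_le hA hB j hz.1 hz.2 hz'.1 hz'.2
  have := (h.hasFDerivAt_stepN hA hB j hy1 hy2).le_of_lipschitzOn (closedBox_mem_nhds hy1 hy2) hlip
  rwa [Real.coe_toNNReal _ hL] at this

end CutoffQuadHyp

end OneScaleEstimates

/-! ## Second-order bounds: the derivatives `D stepK_j`, `D stepN_j` are Lipschitz on the open unit
ball, uniformly in `j` (`‖D²_xφ(x)‖_{L²(X^𝗐,X^𝗏)} ≤ C`, Lemma 3.3 (3.12)–(3.13)) -/

/-- The Lipschitz constant of `D stepK_j` on the unit ball: `M(ϑa_K + 8𝗁)²/a_K`.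
[cite: BauerschmidtBrydgesSlade2015Flow, Lemma 3.3, (3.12)] -/
def derivLipK (Ω B g₀ M hh aK : ℝ) : ℝ := M * (stepRatio Ω B g₀ * aK + 8 * hh) ^ 2 / aK

/-- The Lipschitz constant of `D stepN_j` on the unit ball: `16(2B+14C)Ωε₂𝗁 + M(ϑa_K + 8𝗁)²/𝗁`.
[cite: BauerschmidtBrydgesSlade2015Flow, Lemma 3.3, (3.11)–(3.13)] -/
def derivLipN (Ω B C g₀ M hh aK : ℝ) : ℝ :=
  16 * (2 * B + 14 * C) * Ω * epsLogSq g₀ * hh + M * (stepRatio Ω B g₀ * aK + 8 * hh) ^ 2 / hh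

section SecondOrder

namespace CutoffQuadHyp

variable {P : QuadFlowParams} {Ω : ℝ} {k : ℕ∞} {B c : ℝ} {N : ℕ} {C lam g₀ : ℝ}
  (h : CutoffQuadHyp P Ω k B c N C lam g₀)
include h

variable {W : ℕ → Type*} [∀ j, NormedAddCommGroup (W j)] [∀ j, NormedSpace ℝ (W j)]
  {ψ : ∀ j, W j × V3 → W (j + 1)} {ρ : ∀ j, W j × V3 → V3} {a hh κ R M aStar b : ℝ} {K₀ : W 0}

/-- **The second-derivative bound (1.13) in scaled coordinates, as a Lipschitz bound**: for a `C³` map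
`φ` on `D_j` obeying the order-two bounds of (1.13) with `A = χ_{j+1}g̊_{j+1}³`, `Bq = g̊_{j+1}²|log g̊_{j+1}|`,
the pulled-back derivative `ỹ ↦ Dφ(x_j(ỹ)) ∘ physXL` is `MA(ϑa_K + 8𝗁)²`-Lipschitz on the open unit ball
(mean value inequality for `ỹ ↦ Dφ(x_j(ỹ))[physXL d]`, whose derivative is the second derivative of
`φ` on the weighted directions). [cite: BauerschmidtBrydgesSlade2015Flow, Lemma 3.3, (3.12)–(3.13)] -/
theorem norm_fderiv_comp_physXL_sub_le {F : Type*} [NormedAddCommGroup F] [NormedSpace ℝ F]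
    (hB : BallHyp P ψ Ω k g₀ hh a aStar b K₀) (hM : 0 ≤ M) (j : ℕ) {φ : W j × V3 → F}
    (hφ : ContDiffOn ℝ 3 φ (flowDomain (cutoffWeight Ω k) (P.flow g₀) a hh j))
    (hMB : ∀ x ∈ flowDomain (cutoffWeight Ω k) (P.flow g₀) a hh j,
      MixedDerivBound φ (flowDomain (cutoffWeight Ω k) (P.flow g₀) a hh j) x M
        (cutoffWeight Ω k (j + 1) * P.flow g₀ (j + 1) 0 ^ 3) (P.flow g₀ (j + 1) 0 ^ 2 * |Real.log (P.flow g₀ (j + 1) 0)|))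
    {y y' : W j × V3} (hy : ‖y‖ < 1) (hy' : ‖y'‖ < 1) :
    ‖fderiv ℝ φ (physX P ψ Ω k g₀ hh (a - aStar) K₀ j y) ∘L physXL P Ω k g₀ hh (a - aStar) j -
        fderiv ℝ φ (physX P ψ Ω k g₀ hh (a - aStar) K₀ j y') ∘L physXL P Ω k g₀ hh (a - aStar) j‖ ≤
      M * (cutoffWeight Ω k (j + 1) * gbar P.β g₀ (j + 1) ^ 3) *
        (stepRatio Ω B g₀ * (a - aStar) + 8 * hh) ^ 2 * ‖y - y'‖ := by
  simp only [QuadFlowParams.flow_apply_zero] at hMB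
  set aK := a - aStar with haK_def
  have haK : 0 < aK := by rw [haK_def]; linarith [hB.aStar_lt]
  have hh0 := hB.hh_pos
  set D := flowDomain (E := W j) (cutoffWeight Ω k) (P.flow g₀) a hh j with hD_def
  set A := cutoffWeight Ω k (j + 1) * gbar P.β g₀ (j + 1) ^ 3 with hA_def
  set Bq := gbar P.β g₀ (j + 1) ^ 2 * |Real.log (gbar P.β g₀ (j + 1))| with hBq_def
  have hApos : 0 < A := by rw [hA_def]; have := h.weight_pos (j + 1); have := h.gbar_pos (j + 1); positivity
  have hBqpos : 0 < Bq := by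
    rw [hBq_def]; have := h.gbar_pos (j + 1); have := h.half_le_abs_log_gbar (j + 1); positivity
  have hϑ := h.stepRatio_nonneg
  set Lb : ℝ := M * A * (stepRatio Ω B g₀ * aK + 8 * hh) ^ 2 with hLb_def
  have hLb0 : 0 ≤ Lb := by rw [hLb_def]; positivity
  have hUD : UniqueDiffOn ℝ D := h.uniqueDiffOn_flowDomain hB j
  set U : Set (W j × V3) := Metric.ball 0 1 with hU_def
  have hU : ∀ z ∈ U, ‖z.1‖ < 1 ∧ ‖z.2‖ < 1 := fun z hz =>
    norm_fst_snd_lt_of_norm_lt (mem_ball_zero_iff.1 hz)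
  have hDn : ∀ z ∈ U, D ∈ 𝓝 (physX P ψ Ω k g₀ hh aK K₀ j z) := fun z hz =>
    h.physX_mem_nhds hB j (hU z hz).1 (hU z hz).2
  have hDm : ∀ z ∈ U, physX P ψ Ω k g₀ hh aK K₀ j z ∈ D := fun z hz => mem_of_mem_nhds (hDn z hz)
  set Φ₁ : (W j × V3) → ((W j × V3) →L[ℝ] F) := fderivWithin ℝ φ D with hΦ₁_def
  have hΦ₁ : DifferentiableOn ℝ Φ₁ D :=
    (hφ.fderivWithin hUD (m := 1) (by norm_num)).differentiableOn (by norm_num)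
  have hfd : ∀ z ∈ U, fderiv ℝ φ (physX P ψ Ω k g₀ hh aK K₀ j z) = Φ₁ (physX P ψ Ω k g₀ hh aK K₀ j z) :=
    fun z hz => (fderivWithin_of_mem_nhds (hDn z hz)).symm
  -- the weights along one step
  have hwK : P.wK g₀ Ω k aK j ≤ stepRatio Ω B g₀ * aK * A := by
    have := h.wK_le_stepRatio_mul haK.le j
    have e : P.wK g₀ Ω k aK (j + 1) = aK * A := by rw [hA_def]; rfl
    rw [e] at this; linarith
  have hwG : P.wG g₀ hh j ≤ 8 * hh * Bq := h.wG_le_eight_mul_succ hh0.le j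
  have hwK0 : 0 ≤ P.wK g₀ Ω k aK j := (h.wK_pos haK j).le
  -- the derivative of `z ↦ Φ₁(x(z))[physXL d]` within `U` and its bound
  have hG : ∀ d, ∀ z ∈ U, HasFDerivWithinAt (fun y => Φ₁ (physX P ψ Ω k g₀ hh aK K₀ j y) (physXL P Ω k g₀ hh aK j d))
      ((ContinuousLinearMap.apply ℝ F (physXL P Ω k g₀ hh aK j d)) ∘L
        (fderivWithin ℝ Φ₁ D (physX P ψ Ω k g₀ hh aK K₀ j z) ∘L physXL P Ω k g₀ hh aK j)) U z := by
    intro d z hz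
    have h1 : HasFDerivAt Φ₁ (fderivWithin ℝ Φ₁ D (physX P ψ Ω k g₀ hh aK K₀ j z)) (physX P ψ Ω k g₀ hh aK K₀ j z) :=
      (hΦ₁ _ (hDm z hz)).hasFDerivWithinAt.hasFDerivAt (hDn z hz)
    have h2 := h1.comp z (hasFDerivAt_physX P ψ Ω k g₀ hh aK K₀ j z)
    exact (((ContinuousLinearMap.apply ℝ F (physXL P Ω k g₀ hh aK j d)).hasFDerivAt).comp z h2).hasFDerivWithinAt
  have hGb : ∀ d, ∀ z ∈ U, ‖(ContinuousLinearMap.apply ℝ F (physXL P Ω k g₀ hh aK j d)) ∘L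
      (fderivWithin ℝ Φ₁ D (physX P ψ Ω k g₀ hh aK K₀ j z) ∘L physXL P Ω k g₀ hh aK j)‖ ≤ Lb * ‖d‖ := by
    intro d z hz
    refine ContinuousLinearMap.opNorm_le_bound _ (by positivity) fun δ => ?_
    have hx := hDm z hz
    simp only [ContinuousLinearMap.coe_comp, Function.comp_apply, ContinuousLinearMap.apply_apply,
      physXL_apply]
    have h2 := (hMB _ hx).norm_two_le hUD hx (P.wK g₀ Ω k aK j • δ.1) (P.wK g₀ Ω k aK j • d.1)
      (physV P Ω k g₀ hh j δ.2) (physV P Ω k g₀ hh j d.2)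
    refine h2.trans ?_
    have nδ1 : ‖P.wK g₀ Ω k aK j • δ.1‖ ≤ P.wK g₀ Ω k aK j * ‖δ‖ := by
      rw [norm_smul, Real.norm_eq_abs, abs_of_nonneg hwK0]; gcongr; exact norm_fst_le δ
    have nd1 : ‖P.wK g₀ Ω k aK j • d.1‖ ≤ P.wK g₀ Ω k aK j * ‖d‖ := by
      rw [norm_smul, Real.norm_eq_abs, abs_of_nonneg hwK0]; gcongr; exact norm_fst_le d
    have nδ2 : ‖physV P Ω k g₀ hh j δ.2‖ ≤ P.wG g₀ hh j * ‖δ‖ :=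
      (h.norm_physV_le hh0.le j δ.2).trans (mul_le_mul_of_nonneg_left (norm_snd_le δ) (h.wG_pos hh0 j).le)
    have nd2 : ‖physV P Ω k g₀ hh j d.2‖ ≤ P.wG g₀ hh j * ‖d‖ :=
      (h.norm_physV_le hh0.le j d.2).trans (mul_le_mul_of_nonneg_left (norm_snd_le d) (h.wG_pos hh0 j).le)
    have := weighted_second_order_le hM hApos hBqpos (mul_nonneg hϑ haK.le) hh0.le (norm_nonneg δ) (norm_nonneg d)
      (norm_nonneg _) (norm_nonneg _) nδ1 nδ2 nd1 nd2 hwK hwG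
    rw [hLb_def]
    linarith
  -- the mean value inequality on the unit ball, for each direction `d`
  have hyU : y ∈ U := by rw [hU_def, mem_ball_zero_iff]; exact hy
  have hyU' : y' ∈ U := by rw [hU_def, mem_ball_zero_iff]; exact hy'
  have hmv : ∀ d, ‖Φ₁ (physX P ψ Ω k g₀ hh aK K₀ j y) (physXL P Ω k g₀ hh aK j d) -
      Φ₁ (physX P ψ Ω k g₀ hh aK K₀ j y') (physXL P Ω k g₀ hh aK j d)‖ ≤ Lb * ‖d‖ * ‖y - y'‖ := fun d =>
    (convex_ball (0 : W j × V3) 1).norm_image_sub_le_of_norm_hasFDerivWithin_le (hG d) (hGb d) hyU' hyU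
  -- conclusion
  refine ContinuousLinearMap.opNorm_le_bound _ (by positivity) fun d => ?_
  have happly : (fderiv ℝ φ (physX P ψ Ω k g₀ hh aK K₀ j y) ∘L physXL P Ω k g₀ hh aK j -
      fderiv ℝ φ (physX P ψ Ω k g₀ hh aK K₀ j y') ∘L physXL P Ω k g₀ hh aK j) d =
      Φ₁ (physX P ψ Ω k g₀ hh aK K₀ j y) (physXL P Ω k g₀ hh aK j d) -
        Φ₁ (physX P ψ Ω k g₀ hh aK K₀ j y') (physXL P Ω k g₀ hh aK j d) := by
    rw [← hfd y hyU, ← hfd y' hyU']; rfl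
  rw [happly]
  calc _ ≤ Lb * ‖d‖ * ‖y - y'‖ := hmv d
    _ = Lb * ‖y - y'‖ * ‖d‖ := by ring

/-- **`D stepK_j` is Lipschitz on the open unit ball, uniformly in `j`**:
`‖D stepK_j(ỹ) - D stepK_j(ỹ')‖ ≤ derivLipK·‖ỹ - ỹ'‖`. [cite: BauerschmidtBrydgesSlade2015Flow, Lemma 3.3, (3.12)–(3.13)] -/
theorem norm_stepKDeriv_sub_le (hA : HypA3 (cutoffWeight Ω k) ψ ρ (P.flow g₀) a hh κ Ω R M)
    (hB : BallHyp P ψ Ω k g₀ hh a aStar b K₀) (j : ℕ) {y y' : W j × V3} (hy : ‖y‖ < 1) (hy' : ‖y'‖ < 1) :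
    ‖stepKDeriv P ψ Ω k g₀ hh (a - aStar) K₀ j y - stepKDeriv P ψ Ω k g₀ hh (a - aStar) K₀ j y'‖ ≤
      derivLipK Ω B g₀ M hh (a - aStar) * ‖y - y'‖ := by
  have haK : 0 < a - aStar := by linarith [hB.aStar_lt]
  have hM := hA.M_pos.le
  have hcore := h.norm_fderiv_comp_physXL_sub_le hB hM j (hA.contDiffOn_ψ j) (hA.mixed_ψ j) hy hy'
  have hw1 : 0 < P.wK g₀ Ω k (a - aStar) (j + 1) := h.wK_pos haK (j + 1)
  have hApos : 0 < cutoffWeight Ω k (j + 1) * gbar P.β g₀ (j + 1) ^ 3 := by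
    have := h.weight_pos (j + 1); have := h.gbar_pos (j + 1); positivity
  have e : stepKDeriv P ψ Ω k g₀ hh (a - aStar) K₀ j y - stepKDeriv P ψ Ω k g₀ hh (a - aStar) K₀ j y' =
      (P.wK g₀ Ω k (a - aStar) (j + 1))⁻¹ •
        (fderiv ℝ (ψ j) (physX P ψ Ω k g₀ hh (a - aStar) K₀ j y) ∘L physXL P Ω k g₀ hh (a - aStar) j -
          fderiv ℝ (ψ j) (physX P ψ Ω k g₀ hh (a - aStar) K₀ j y') ∘L physXL P Ω k g₀ hh (a - aStar) j) := by
    simp only [stepKDeriv, smul_sub]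
  rw [e, norm_smul, Real.norm_eq_abs, abs_of_pos (inv_pos.2 hw1), inv_mul_le_iff₀ hw1]
  refine hcore.trans (le_of_eq ?_)
  unfold derivLipK QuadFlowParams.wK
  field_simp

/-- **`D stepN_j` is Lipschitz on the open unit ball, uniformly in `j`**:
`‖D stepN_j(ỹ) - D stepN_j(ỹ')‖ ≤ derivLipN·‖ỹ - ỹ'‖` (the quadratic part through the `O(χ_j)` size of
the coefficients of `φ̄_j`, the `ρ`-part through (1.13)). [cite: BauerschmidtBrydgesSlade2015Flow, Lemma 3.3, (3.11)–(3.13)] -/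
theorem norm_stepNDeriv_sub_le (hA : HypA3 (cutoffWeight Ω k) ψ ρ (P.flow g₀) a hh κ Ω R M)
    (hB : BallHyp P ψ Ω k g₀ hh a aStar b K₀) (j : ℕ) {y y' : W j × V3} (hy : ‖y‖ < 1) (hy' : ‖y'‖ < 1) :
    ‖stepNDeriv P ψ ρ Ω k g₀ hh (a - aStar) K₀ j y - stepNDeriv P ψ ρ Ω k g₀ hh (a - aStar) K₀ j y'‖ ≤
      derivLipN Ω B C g₀ M hh (a - aStar) * ‖y - y'‖ := by
  have haK : 0 < a - aStar := by linarith [hB.aStar_lt]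
  have hM := hA.M_pos.le; have hh0 := hB.hh_pos
  have hcore := h.norm_fderiv_comp_physXL_sub_le hB hM j (hA.contDiffOn_ρ j) (hA.mixed_ρ j) hy hy'
  have hv1 : 0 < P.vV g₀ Ω k hh (j + 1) := h.vV_pos hh0 (j + 1)
  have hApos : 0 < cutoffWeight Ω k (j + 1) * gbar P.β g₀ (j + 1) ^ 3 := by
    have := h.weight_pos (j + 1); have := h.gbar_pos (j + 1); positivity
  -- the quadratic part
  have hG0 := (h.wG_pos hh0 j).le
  have hquad : ‖(P.dmap j (P.flow g₀ j + physV P Ω k g₀ hh j y.2) - P.dmap j (P.flow g₀ j + physV P Ω k g₀ hh j y'.2)) ∘L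
      (physVL P Ω k g₀ hh j ∘L ContinuousLinearMap.snd ℝ (W j) V3)‖ ≤
      2 * ((2 * B + 14 * C) * (cutoffWeight Ω k j * P.wG g₀ hh j ^ 2)) * ‖y - y'‖ := by
    have hdm := P.norm_dmap_sub_dmap_le j (P.flow g₀ j + physV P Ω k g₀ hh j y'.2) (P.flow g₀ j + physV P Ω k g₀ hh j y.2)
    rw [add_sub_add_left_eq_sub, physV_sub] at hdm
    have hcoef := h.coefSum_le j
    have hV : ‖physV P Ω k g₀ hh j (y.2 - y'.2)‖ ≤ P.wG g₀ hh j * ‖y - y'‖ :=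
      (h.norm_physV_le hh0.le j _).trans (mul_le_mul_of_nonneg_left
        (by rw [← Prod.snd_sub]; exact norm_snd_le _) hG0)
    have hL : ‖physVL P Ω k g₀ hh j ∘L ContinuousLinearMap.snd ℝ (W j) V3‖ ≤ 2 * P.wG g₀ hh j := by
      have hn := h.norm_physVL_le (k := k) (Ω := Ω) hh0 j
      refine ContinuousLinearMap.opNorm_le_bound _ (by positivity) fun z => ?_
      calc ‖(physVL P Ω k g₀ hh j ∘L ContinuousLinearMap.snd ℝ (W j) V3) z‖ = ‖physVL P Ω k g₀ hh j z.2‖ := rfl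
        _ ≤ ‖physVL P Ω k g₀ hh j‖ * ‖z.2‖ := ContinuousLinearMap.le_opNorm _ _
        _ ≤ 2 * P.wG g₀ hh j * ‖z‖ := mul_le_mul hn (norm_snd_le z) (norm_nonneg _) (by positivity)
    have hχ := (h.weight_pos j).le
    have hBC : 0 ≤ 2 * B + 14 * C := by have := h.B_nonneg; have := h.C_nonneg; positivity
    calc _ ≤ ‖P.dmap j (P.flow g₀ j + physV P Ω k g₀ hh j y.2) - P.dmap j (P.flow g₀ j + physV P Ω k g₀ hh j y'.2)‖ *
          ‖physVL P Ω k g₀ hh j ∘L ContinuousLinearMap.snd ℝ (W j) V3‖ := ContinuousLinearMap.opNorm_comp_le _ _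
      _ ≤ ((2 * B + 14 * C) * cutoffWeight Ω k j * (P.wG g₀ hh j * ‖y - y'‖)) * (2 * P.wG g₀ hh j) := by
          refine mul_le_mul (hdm.trans ?_) hL (norm_nonneg _) (by positivity)
          exact mul_le_mul hcoef hV (norm_nonneg _) (by positivity)
      _ = _ := by ring
  have hR4 := h.chi_wG_sq_le (hh := hh) hB.small2 j
  -- assemble
  have e : stepNDeriv P ψ ρ Ω k g₀ hh (a - aStar) K₀ j y - stepNDeriv P ψ ρ Ω k g₀ hh (a - aStar) K₀ j y' =
      (P.vV g₀ Ω k hh (j + 1))⁻¹ •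
        ((P.dmap j (P.flow g₀ j + physV P Ω k g₀ hh j y.2) - P.dmap j (P.flow g₀ j + physV P Ω k g₀ hh j y'.2)) ∘L
            (physVL P Ω k g₀ hh j ∘L ContinuousLinearMap.snd ℝ (W j) V3) +
          (fderiv ℝ (ρ j) (physX P ψ Ω k g₀ hh (a - aStar) K₀ j y) ∘L physXL P Ω k g₀ hh (a - aStar) j -
            fderiv ℝ (ρ j) (physX P ψ Ω k g₀ hh (a - aStar) K₀ j y') ∘L physXL P Ω k g₀ hh (a - aStar) j)) := by
    simp only [stepNDeriv, ContinuousLinearMap.sub_comp, smul_sub, smul_add]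
    abel
  rw [e, norm_smul, Real.norm_eq_abs, abs_of_pos (inv_pos.2 hv1), inv_mul_le_iff₀ hv1]
  refine (norm_add_le _ _).trans ?_
  refine (add_le_add hquad hcore).trans ?_
  have hBC : 0 ≤ 2 * B + 14 * C := by have := h.B_nonneg; have := h.C_nonneg; positivity
  have hΩ : 0 ≤ Ω := by linarith [h.one_lt]
  have hn := norm_nonneg (y - y')
  calc 2 * ((2 * B + 14 * C) * (cutoffWeight Ω k j * P.wG g₀ hh j ^ 2)) * ‖y - y'‖ +
        M * (cutoffWeight Ω k (j + 1) * gbar P.β g₀ (j + 1) ^ 3) * (stepRatio Ω B g₀ * (a - aStar) + 8 * hh) ^ 2 * ‖y - y'‖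
      ≤ 2 * ((2 * B + 14 * C) * (8 * Ω * epsLogSq g₀ * hh * (hh * (cutoffWeight Ω k (j + 1) * gbar P.β g₀ (j + 1) ^ 3)))) * ‖y - y'‖ +
        M * (cutoffWeight Ω k (j + 1) * gbar P.β g₀ (j + 1) ^ 3) * (stepRatio Ω B g₀ * (a - aStar) + 8 * hh) ^ 2 * ‖y - y'‖ := by
        gcongr
    _ = P.vV g₀ Ω k hh (j + 1) * (derivLipN Ω B C g₀ M hh (a - aStar) * ‖y - y'‖) := by
        unfold derivLipN QuadFlowParams.vV
        field_simp
        ring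

end CutoffQuadHyp

end SecondOrder

/-! ## Sequence level: `T` is strictly Fréchet differentiable on the open unit ball, `‖DT‖ ≤ θ` -/

section SequenceLevelPrelim

variable {W : ℕ → Type*} [∀ j, NormedAddCommGroup (W j)] [∀ j, NormedSpace ℝ (W j)]
  {P : QuadFlowParams} {ψ : ∀ j, W j × V3 → W (j + 1)} {Ω : ℝ} {k : ℕ∞} {g₀ hh a aStar b : ℝ} {K₀ : W 0}

omit [∀ j, NormedSpace ℝ (W j)] in
/-- `BallHyp` at level `1` from `BallHyp` at any level (its `b`-independent fields). [cite: BauerschmidtBrydgesSlade2015Flow, Theorem 1.4 (hypotheses)] -/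
theorem CutoffQuadHyp.BallHyp.one (hB : CutoffQuadHyp.BallHyp P ψ Ω k g₀ hh a aStar b K₀) :
    CutoffQuadHyp.BallHyp P ψ Ω k g₀ hh a aStar 1 K₀ :=
  ⟨hB.hh_pos, zero_lt_one, le_rfl, hB.aStar_nonneg, hB.aStar_lt, hB.Kbar_le, hB.small1, hB.small2⟩

omit [∀ j, NormedSpace ℝ (W j)] in
/-- The ball `scaledBall β` is a neighbourhood of every point with `‖K̃‖, ‖Ṽ‖ < β`. [folklore] -/
theorem scaledBall_mem_nhds {β : ℝ} {y : SeqK W × SeqV} (hy1 : ‖y.1‖ < β) (hy2 : ‖y.2‖ < β) :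
    scaledBall W β ∈ 𝓝 y := by
  have hy : ‖y‖ < β := by rw [Prod.norm_def]; exact max_lt hy1 hy2
  have hball : Metric.ball (0 : SeqK W × SeqV) β ∈ 𝓝 y := Metric.isOpen_ball.mem_nhds (by simpa using hy)
  refine Filter.mem_of_superset hball fun z hz => ?_
  rw [mem_ball_zero_iff, Prod.norm_def, max_lt_iff] at hz
  exact ⟨hz.1.le, hz.2.le⟩

omit [∀ j, NormedSpace ℝ (W j)] in
/-- The closed unit ball `scaledBall 1` is a neighbourhood of every point of the open unit ball. [folklore] -/
theorem scaledBall_one_mem_nhds {y : SeqK W × SeqV} (hy : ‖y‖ < 1) : scaledBall W 1 ∈ 𝓝 y := by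
  have h := norm_fst_snd_lt_of_norm_lt hy
  exact scaledBall_mem_nhds h.1 h.2

end SequenceLevelPrelim

section SequenceLevel

namespace CutoffQuadHyp

variable {P : QuadFlowParams} {Ω : ℝ} {k : ℕ∞} {B c : ℝ} {N : ℕ} {C lam g₀ : ℝ}
  (h : CutoffQuadHyp P Ω k B c N C lam g₀)
include h

variable {W : ℕ → Type*} [∀ j, NormedAddCommGroup (W j)] [∀ j, NormedSpace ℝ (W j)]
  {ψ : ∀ j, W j × V3 → W (j + 1)} {ρ : ∀ j, W j × V3 → V3} {a hh κ R M aStar b : ℝ} {K₀ : W 0}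

/-- The `𝒦`-row of `T` in Nemytskii form: on the closed unit ball,
`(Tỹ)^K = lpCons (stepK_j(ỹ_j))_j`. [cite: BauerschmidtBrydgesSlade2015Flow, §3.3, (3.8)] -/
theorem Tmap_fst_eq (hA : HypA3 (cutoffWeight Ω k) ψ ρ (P.flow g₀) a hh κ Ω R M)
    (hB : BallHyp P ψ Ω k g₀ hh a aStar b K₀) (S : SeqV →L[ℝ] SeqV) {y : SeqK W × SeqV}
    (hy : y ∈ scaledBall W 1) :
    (Tmap P ψ ρ Ω k g₀ hh (a - aStar) K₀ S y).1 =
      lpCons (toLp fun j => stepK P ψ Ω k g₀ hh (a - aStar) K₀ j ((lpZip y : lp (fun j => W j × V3) ∞) j)) := by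
  have hB1 := hB.one
  have hmem : Memℓp (fun j => stepK P ψ Ω k g₀ hh (a - aStar) K₀ j ((lpZip y : lp (fun j => W j × V3) ∞) j)) ∞ :=
    memℓp_of_forall_norm_le fun j => h.norm_stepK_le' hA hB j
      ((lp.norm_apply_le_norm ENNReal.top_ne_zero y.1 j).trans hy.1)
      ((lp.norm_apply_le_norm ENNReal.top_ne_zero y.2 j).trans hy.2)
  apply lp.ext
  rw [h.coe_Tmap_fst hA hB1 S hy, coe_lpCons, coe_toLp hmem]
  funext j
  cases j with
  | zero => rfl
  | succ j => rfl

/-- The `𝒱`-source of `T` in Nemytskii form: on the closed unit ball, `Ñ(ỹ) = lpCons (stepN_j(ỹ_j))_j`.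
[cite: BauerschmidtBrydgesSlade2015Flow, §3.3, (3.8)] -/
theorem toSeqV_srcN_eq (hA : HypA3 (cutoffWeight Ω k) ψ ρ (P.flow g₀) a hh κ Ω R M)
    (hB : BallHyp P ψ Ω k g₀ hh a aStar b K₀) {y : SeqK W × SeqV} (hy : y ∈ scaledBall W 1) :
    toSeqV (srcN P ψ ρ Ω k g₀ hh (a - aStar) K₀ ((y.1 : ∀ j, W j), (y.2 : ℕ → V3))) =
      lpCons (toLp fun j => stepN P ψ ρ Ω k g₀ hh (a - aStar) K₀ j ((lpZip y : lp (fun j => W j × V3) ∞) j)) := by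
  have hB1 := hB.one
  have hmem : Memℓp (fun j => stepN P ψ ρ Ω k g₀ hh (a - aStar) K₀ j ((lpZip y : lp (fun j => W j × V3) ∞) j)) ∞ :=
    memℓp_of_forall_norm_le fun j => h.norm_stepN_le' hA hB j
      ((lp.norm_apply_le_norm ENNReal.top_ne_zero y.1 j).trans hy.1)
      ((lp.norm_apply_le_norm ENNReal.top_ne_zero y.2 j).trans hy.2)
  apply lp.ext
  rw [h.coe_toSeqV_srcN hA hB1 hy, coe_lpCons, coe_toLp hmem]
  funext j
  cases j with
  | zero => rfl
  | succ j => rfl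

/-- **[BBS-rg-flow, Lemma 3.3 (differentiability) for the flow map]: `T` is strictly Fréchet
differentiable at every point of the open unit ball** of `ℓ^∞(∏𝒲_j) × ℓ^∞(ℝ³)`, its derivative being
`(lpCons ∘ diag(D stepK_j(ỹ_j)) ∘ lpZip, S ∘ lpCons ∘ diag(D stepN_j(ỹ_j)) ∘ lpZip)` (componentwise mean value
estimates from the `j`-uniform Lipschitz bounds of the one-scale derivatives, i.e. from the second
derivatives of (A3)). [cite: BauerschmidtBrydgesSlade2015Flow, Lemma 3.3 ("twice continuously Fréchet differentiable") and §3.4] -/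
theorem hasStrictFDerivAt_Tmap (hA : HypA3 (cutoffWeight Ω k) ψ ρ (P.flow g₀) a hh κ Ω R M)
    (hB : BallHyp P ψ Ω k g₀ hh a aStar b K₀) (S : SeqV →L[ℝ] SeqV) {y : SeqK W × SeqV} (hy : ‖y‖ < 1) :
    ∃ T' : (SeqK W × SeqV) →L[ℝ] (SeqK W × SeqV), HasStrictFDerivAt (Tmap P ψ ρ Ω k g₀ hh (a - aStar) K₀ S) T' y := by
  set aK := a - aStar with haK_def
  set x₀ : lp (fun j => W j × V3) ∞ := lpZip y with hx₀
  set r : ℝ := (1 - ‖y‖) / 2 with hr_def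
  have hr : 0 < r := by rw [hr_def]; linarith
  have hx₀n : ‖x₀‖ = ‖y‖ := norm_lpZip y
  -- components of points of the componentwise balls lie in the open unit ball
  have hcomp : ∀ j, ∀ z ∈ Metric.closedBall (x₀ j) r, ‖z‖ < 1 := fun j z hz => by
    rw [Metric.mem_closedBall, dist_eq_norm] at hz
    have h1 : ‖x₀ j‖ ≤ ‖y‖ := hx₀n ▸ lp.norm_apply_le_norm ENNReal.top_ne_zero x₀ j
    calc ‖z‖ = ‖(z - x₀ j) + x₀ j‖ := by rw [sub_add_cancel]
      _ ≤ ‖z - x₀ j‖ + ‖x₀ j‖ := norm_add_le _ _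
      _ ≤ r + ‖y‖ := add_le_add hz h1
      _ < 1 := by rw [hr_def]; linarith
  have hcomp' : ∀ j, ∀ z ∈ Metric.closedBall (x₀ j) r, ‖z.1‖ < 1 ∧ ‖z.2‖ < 1 := fun j z hz =>
    norm_fst_snd_lt_of_norm_lt (hcomp j z hz)
  have hx₀j : ∀ j, ‖(x₀ j).1‖ < 1 ∧ ‖(x₀ j).2‖ < 1 := fun j =>
    hcomp' j (x₀ j) (Metric.mem_closedBall_self hr.le)
  -- the `𝒦`-Nemytskii operator
  have hCK : ∀ j, ‖stepKDeriv P ψ Ω k g₀ hh aK K₀ j (x₀ j)‖ ≤ lipK Ω B g₀ κ M hh aK := fun j =>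
    h.norm_stepKDeriv_le hA hB j (hx₀j j).1 (hx₀j j).2
  have hLK : 0 ≤ derivLipK Ω B g₀ M hh aK := by
    unfold derivLipK; have := hA.M_pos.le; have : 0 < aK := by rw [haK_def]; linarith [hB.aStar_lt]
    positivity
  have hNK := hasStrictFDerivAt_lpNemytskii (x₀ := x₀) hr hLK
    (fun j => stepK P ψ Ω k g₀ hh aK K₀ j) (fun j => stepKDeriv P ψ Ω k g₀ hh aK K₀ j)
    (fun j z hz => h.hasFDerivAt_stepK hA hB j (hcomp' j z hz).1 (hcomp' j z hz).2)
    (fun j => h.norm_stepK_le' hA hB j (hx₀j j).1.le (hx₀j j).2.le) hCK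
    (fun j z hz z' hz' => h.norm_stepKDeriv_sub_le hA hB j (hcomp j z hz) (hcomp j z' hz'))
  -- the `𝒱`-Nemytskii operator
  have hCN : ∀ j, ‖stepNDeriv P ψ ρ Ω k g₀ hh aK K₀ j (x₀ j)‖ ≤ lipN Ω B C g₀ M hh aK 1 := fun j =>
    h.norm_stepNDeriv_le hA hB j (hx₀j j).1 (hx₀j j).2
  have hLN : 0 ≤ derivLipN Ω B C g₀ M hh aK := by
    unfold derivLipN
    have := hA.M_pos.le; have := hB.hh_pos.le; have := h.epsLogSq_nonneg
    have : 0 ≤ 2 * B + 14 * C := by have := h.B_nonneg; have := h.C_nonneg; positivity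
    have : 0 ≤ Ω := by linarith [h.one_lt]
    positivity
  have hNN := hasStrictFDerivAt_lpNemytskii (x₀ := x₀) hr hLN
    (fun j => stepN P ψ ρ Ω k g₀ hh aK K₀ j) (fun j => stepNDeriv P ψ ρ Ω k g₀ hh aK K₀ j)
    (fun j z hz => h.hasFDerivAt_stepN hA hB j (hcomp' j z hz).1 (hcomp' j z hz).2)
    (fun j => h.norm_stepN_le' hA hB j (hx₀j j).1.le (hx₀j j).2.le) hCN
    (fun j z hz z' hz' => h.norm_stepNDeriv_sub_le hA hB j (hcomp j z hz) (hcomp j z' hz'))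
  -- compose with the linear plumbing
  have hzip : HasStrictFDerivAt (fun y : SeqK W × SeqV => (lpZip y : lp (fun j => W j × V3) ∞)) lpZip y :=
    (lpZip (E := W) (F := fun _ : ℕ => V3)).hasStrictFDerivAt
  have hK := ((lpCons (E := W)).hasStrictFDerivAt.comp y (hNK.comp y hzip))
  have hN := (S ∘L (lpCons (E := fun _ : ℕ => V3))).hasStrictFDerivAt.comp y (hNN.comp y hzip)
  refine ⟨_, (hK.prodMk hN).congr_of_eventuallyEq ?_⟩
  -- `T` agrees with the composite near `y`
  filter_upwards [scaledBall_one_mem_nhds (W := W) hy] with z hz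
  refine Prod.ext ?_ ?_
  · exact (h.Tmap_fst_eq hA hB S hz).symm
  · show (S ∘L lpCons) (toLp fun j => stepN P ψ ρ Ω k g₀ hh aK K₀ j ((lpZip z : lp (fun j => W j × V3) ∞) j)) =
      (Tmap P ψ ρ Ω k g₀ hh aK K₀ S z).2
    rw [Tmap_snd, ContinuousLinearMap.coe_comp, Function.comp_apply, h.toSeqV_srcN_eq hA hB hz]

/-- **`‖DT(ỹ)‖ ≤ θ` inside a ball on which `T` is a `θ`-contraction** (a derivative is bounded by a
Lipschitz constant). [cite: BauerschmidtBrydgesSlade2015Flow, Lemma 3.3, (3.10)–(3.11) and Lemma 3.5 (the role of ‖S‖)] -/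
theorem norm_fderiv_Tmap_le (hA : HypA3 (cutoffWeight Ω k) ψ ρ (P.flow g₀) a hh κ Ω R M)
    {β : ℝ} (hB : BallHyp P ψ Ω k g₀ hh a aStar β K₀) {S : SeqV →L[ℝ] SeqV} {θ : ℝ}
    (hS : SmallHyp Ω B C g₀ κ M hh (a - aStar) β θ S) {y : SeqK W × SeqV} (hy1 : ‖y.1‖ < β) (hy2 : ‖y.2‖ < β)
    {T' : (SeqK W × SeqV) →L[ℝ] (SeqK W × SeqV)} (hT : HasFDerivAt (Tmap P ψ ρ Ω k g₀ hh (a - aStar) K₀ S) T' y) :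
    ‖T'‖ ≤ θ := by
  have := hT.le_of_lipschitzOn (scaledBall_mem_nhds hy1 hy2) (h.lipschitzOnWith_Tmap hA hB hS)
  rwa [Real.coe_toNNReal _ hS.θ_nonneg] at this

end CutoffQuadHyp

end SequenceLevel





end CTWSAW

end Literature.Barriers.CriticalPhenomena
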